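import Mathlib
import Summits.AtomisticToContinuum.HydrodynamicLimit.Theorems.InformationPercolationEngineKickFairRelEquilibriumMesoEnergyTail
import Summits.AtomisticToContinuum.HydrodynamicLimit.Theorems.JParityClosureCollisionTightnessDomination
import Literature.MathematicalPhysics.KineticTheory.HardSphereEulerProofs
import HarnessLib

/-!
# Stub `localGibbsLaw_kinEnergy_tail` of the line `kinetic-window-cut` (rev 5) for the crux
`KickFairRelEquilibriumMeso` (stmt-AtomisticToContinuum-15177)

Exponential upper tail of (twice) the kinetic energy `KE = Σᵢ ‖vᵢ‖²` under the LOCAL Gibbs laws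
`localGibbsLaw σ a₀ u₀ θ₀ N Φ` with continuous profiles `a₀, θ₀ > 0`, `u₀` (`0 < σ < 1/2`): there are a
cap `K` and a threshold `N₀` with `LG {KE > K (N+1)} ≤ e^{-(N+1)}` for all `N ≥ N₀`, uniformly in `σ`
and in the flow. The close-pair count of rev 5 (CPL) is deterministic on the energy-typical set
`{KE ≤ K (N+1)}`; this is the bound for the local Gibbs law of its complement.

Proof: by the domination lemma `exists_localGibbsMeasure_le_smul_const` there are `θ₁ > 0` and `Λ ≥ 1`
with `localGibbsMeasure σ a₀ u₀ θ₀ N ≤ Λ^{N+1} • localGibbsMeasure σ 1 0 θ₁ N` (`σ ≤ 1/2`); the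
equilibrium energy tail `stub_energyTail` at temperature `θ₁` and rate `M = log Λ + 1` gives `K, N₀` with
`G_{θ₁} {KE > K (N+1)} ≤ e^{-M (N+1)}`; hence `LG {KE > K(N+1)} ≤ Λ^{N+1} e^{-(log Λ + 1)(N+1)} = e^{-(N+1)}`
(`localGibbsLaw_eq` identifies the law with the measure, the energy event being flow-independent).
-/

noncomputable section

open MeasureTheory Set Filter Topology
open scoped ENNReal Classical

namespace Summit.AtomisticToContinuum.HydrodynamicLimit.Theorems.KickFairRelEquilibriumMesoLine

open Literature.Analysis.FluidPDE Literature.MathematicalPhysics.KineticTheory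

/-- **Exponential upper tail of the kinetic energy under the local Gibbs laws.** For continuous
profiles `a₀, θ₀ > 0`, `u₀` there are a cap `K` and a threshold `N₀` such that for all `N ≥ N₀`, all
`0 < σ < 1/2` and every hard-sphere flow `Φ`,
`localGibbsLaw σ a₀ u₀ θ₀ N Φ {KE > K (N+1)} ≤ e^{-(N+1)}` (`KE = Σᵢ ‖vᵢ‖²`): domination of the local
Gibbs law by a homogeneous Gibbs law at the cost `Λ^{N+1}` (`exists_localGibbsMeasure_le_smul_const`)
and the equilibrium Chernoff bound `stub_energyTail` at rate `log Λ + 1`. [folklore] -/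
theorem localGibbsLaw_kinEnergy_tail : ∀ (a₀ θ₀ : T3 → ℝ) (u₀ : T3 → V3), Continuous a₀ → Continuous θ₀ → Continuous u₀ →
    (∀ x, 0 < a₀ x) → (∀ x, 0 < θ₀ x) →
    ∃ K : ℝ, ∃ N₀ : ℕ, ∀ N : ℕ, N₀ ≤ N → ∀ σ : ℝ, 0 < σ → σ < 1 / 2 → ∀ Φ : Flow σ N,
      localGibbsLaw σ a₀ u₀ θ₀ N Φ {z | K * ((N : ℝ) + 1) < kinEnergy z} ≤ ENNReal.ofReal (Real.exp (-((N : ℝ) + 1))) := by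
  intro a₀ θ₀ u₀ ha hθ hu ha0 hθ0
  -- domination of the local Gibbs law by a homogeneous Gibbs law, at the exponential cost `Λ^{N+1}`
  obtain ⟨θ₁, hθ₁, Λ, hΛ, hdom⟩ := exists_localGibbsMeasure_le_smul_const ha hθ hu ha0 hθ0
  have hΛ0 : 0 < Λ := one_pos.trans_le hΛ
  have hM : 0 ≤ Real.log Λ + 1 := add_nonneg (Real.log_nonneg hΛ) zero_le_one
  -- the equilibrium energy tail at temperature `θ₁` and rate `log Λ + 1`
  obtain ⟨K, N₀, hK⟩ := stub_energyTail θ₁ hθ₁ (Real.log Λ + 1) hM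
  refine ⟨K, N₀, fun N hN σ hσ hσ2 Φ => ?_⟩
  -- the arithmetic of the budget: `Λ^{N+1} e^{-(log Λ + 1)(N+1)} = e^{-(N+1)}`
  have hΛc : Λ * Real.exp (-(Real.log Λ + 1)) = Real.exp (-1) := by
    rw [neg_add, Real.exp_add, Real.exp_neg (Real.log Λ), Real.exp_log hΛ0]
    field_simp
  have hprod : Λ ^ (N + 1) * Real.exp (-((Real.log Λ + 1) * ((N : ℝ) + 1))) =
      Real.exp (-((N : ℝ) + 1)) := by
    rw [show -((Real.log Λ + 1) * ((N : ℝ) + 1)) = ((N + 1 : ℕ) : ℝ) * (-(Real.log Λ + 1)) by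
        push_cast; ring,
      Real.exp_nat_mul, ← mul_pow, hΛc, ← Real.exp_nat_mul]
    congr 1
    push_cast
    ring
  calc localGibbsLaw σ a₀ u₀ θ₀ N Φ {z | K * ((N : ℝ) + 1) < kinEnergy z}
      = localGibbsMeasure σ a₀ u₀ θ₀ N {z | K * ((N : ℝ) + 1) < kinEnergy z} := by
        rw [localGibbsLaw_eq]
    _ ≤ (ENNReal.ofReal (Λ ^ (N + 1)) •
          localGibbsMeasure σ (fun _ => 1) (fun _ => (0 : V3)) (fun _ => θ₁) N)
          {z | K * ((N : ℝ) + 1) < kinEnergy z} :=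
        Measure.le_iff'.1 (hdom σ hσ2.le N) _
    _ = ENNReal.ofReal (Λ ^ (N + 1)) *
          localGibbsLaw σ (fun _ => 1) (fun _ => (0 : V3)) (fun _ => θ₁) N Φ
          {z | K * ((N : ℝ) + 1) < kinEnergy z} := by
        rw [Measure.smul_apply, smul_eq_mul, localGibbsLaw_eq]
    _ ≤ ENNReal.ofReal (Λ ^ (N + 1)) *
          ENNReal.ofReal (Real.exp (-((Real.log Λ + 1) * ((N : ℝ) + 1)))) := by
        gcongr
        exact hK N hN σ hσ hσ2 Φ
    _ = ENNReal.ofReal (Λ ^ (N + 1) * Real.exp (-((Real.log Λ + 1) * ((N : ℝ) + 1)))) :=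
        (ENNReal.ofReal_mul (by positivity)).symm
    _ = ENNReal.ofReal (Real.exp (-((N : ℝ) + 1))) := by rw [hprod]

end Summit.AtomisticToContinuum.HydrodynamicLimit.Theorems.KickFairRelEquilibriumMesoLine

end
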